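import Summits.CriticalPhenomena.PercolationContinuityZ3.Theorems.PercNearOneGluingNoHeavyLowerTailAntitheticMonotoneCube
import HarnessLib

/-!
# `NoHeavyLowerTail` (stmt-CriticalPhenomena-4575) — antithetic cluster pairs: ONE-SIDED (dominated) CUBES, SUPER-ODD test functions and
# the abstract CUT-VERTEX COMPOSITION lemma (prim-hp-2 gen 56, HOME/THEOREM-OneSided.md Lemma 1 and Theorem OS⊕-C)

Support file (`--supports stmt-CriticalPhenomena-4575`, hull-port prover `prim-hp-2`, gen 56).  No definitions, no named facts, no sorries;
standard axioms.  Purely abstract (finite sums over Boolean lattices); the graph-side instantiation (deg-2 elimination, block freezing) is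
HOME/THEOREM-OneSided.md, to be formalised separately.

A function `K : Set V → Set V → ℝ` of a pair (red cluster, blue cluster) is TWISTED-MONOTONE if it increases when the first argument grows and
the second shrinks, and SUPER-ODD if `K P Q + K Q P ≥ 0` (odd functions, nonnegative functions and shifted odd functions
`(P,Q) ↦ h (P ∪ A) Q` are super-odd).  A ONE-SIDED (red-dominated) CUBE is a pair `Wr, Wb : Set ι → Set V`, `Wr` monotone, `Wb` antitone,
with ANTIPODAL DOMINATION `Wb Tᶜ ⊆ Wr T` for all `T` (MEMO-gen52 §2: the leaves of symmetric Harris trees; MEMO-gen56: the blocks obtained by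
freezing the edges at the blue cluster of a vertex).

* `Antithetic.superodd_cube_sum_nonneg` (ONE-SIDED CUBE LEMMA): on a red-dominated cube, `Σ_T K₁(Wr T, Wb T)·K₂(Wr T, Wb T) ≥ 0` for
  super-odd twisted-monotone `K₁, K₂` — Harris' inequality on `Set ι` plus the antipodal pairing `T ↔ Tᶜ`, which gives both means `≥ 0`.
  (With `K = F(P) − G(Q)`… it contains the red case of `monotone_cube_sum_nonneg`.)
* `Antithetic.oplus_composition_sum_nonneg` (ABSTRACT CUT-VERTEX COMPOSITION, THEOREM OS⊕-C of HOME/THEOREM-OneSided.md): if a finite family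
  of pairs `(P₁ j, Q₁ j)` is ⊕-POSITIVE (every super-odd twisted-monotone pair `K₁, K₂` has `Σ_j K₁K₂ ≥ 0`) and `(Wr, Wb)` is a red-dominated
  cube, then for ODD twisted-monotone `h₁, h₂` and any fixed vertex set `A`,
  `Σ_j Σ_T h₁(P₁ j ∪ Wr T ∪ A, Q₁ j ∪ Wb T)·h₂(…) ≥ 0`: Harris in `T` for each `j` bounds the inner sum below by
  `K₁(P₁ j, Q₁ j)·K₂(P₁ j, Q₁ j)/2^{|ι|}` with `K_i(P,Q) = Σ_T h_i(P ∪ Wr T ∪ A, Q ∪ Wb T)`, which is twisted-monotone and — by antipodal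
  domination — super-odd.  In the application `j` runs over the colourings of one side `G₁` of a cut vertex with `y` in the red cluster,
  `T` over the free edges of a frozen block of the other side, `A = {x, s}`.
* `Antithetic.cube_composition_sum_nonneg`: the same with side 1 itself a red-dominated cube (⊕-positivity by the cube lemma) — products of
  one-sided cubes are one-sided.
[cite: VandenbergHaggstromKahn2005, §1 p. 6 ("Harris' inequality")]
-/

noncomputable section

namespace Summit.CriticalPhenomena.PercolationContinuityZ3.Theorems

open scoped Classical

namespace Antithetic

section OneSided

variable {V : Type*} {ι : Type*} [Fintype ι]

/-- **One-sided cube lemma** (HOME/THEOREM-OneSided.md Lemma 1).  `Wr` monotone, `Wb` antitone on `Set ι` with antipodal domination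
`Wb Tᶜ ⊆ Wr T`; `K₁, K₂` twisted-monotone (`P ⊆ P'`, `Q' ⊆ Q` ⇒ `K P Q ≤ K P' Q'`) and super-odd (`0 ≤ K P Q + K Q P`).  Then
`0 ≤ Σ_T K₁ (Wr T) (Wb T) * K₂ (Wr T) (Wb T)`. [this work] -/
theorem superodd_cube_sum_nonneg (Wr Wb : Set ι → Set V) (hWr : Monotone Wr) (hWb : Antitone Wb)
    (hdom : ∀ T, Wb Tᶜ ⊆ Wr T) {K₁ K₂ : Set V → Set V → ℝ}
    (hK₁ : ∀ ⦃P P' Q Q' : Set V⦄, P ⊆ P' → Q' ⊆ Q → K₁ P Q ≤ K₁ P' Q') (hso₁ : ∀ P Q, 0 ≤ K₁ P Q + K₁ Q P)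
    (hK₂ : ∀ ⦃P P' Q Q' : Set V⦄, P ⊆ P' → Q' ⊆ Q → K₂ P Q ≤ K₂ P' Q') (hso₂ : ∀ P Q, 0 ≤ K₂ P Q + K₂ Q P) :
    0 ≤ ∑ T : Set ι, K₁ (Wr T) (Wb T) * K₂ (Wr T) (Wb T) := by
  let a : Set ι → ℝ := fun T => K₁ (Wr T) (Wb T)
  let b : Set ι → ℝ := fun T => K₂ (Wr T) (Wb T)
  show 0 ≤ ∑ T : Set ι, a T * b T
  have ha : Monotone a := fun T T' hTT' => hK₁ (hWr hTT') (hWb hTT')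
  have hb : Monotone b := fun T T' hTT' => hK₂ (hWr hTT') (hWb hTT')
  have hsumc : ∀ (c : Set ι → ℝ), ∑ T : Set ι, c Tᶜ = ∑ T : Set ι, c T := fun c =>
    Fintype.sum_equiv (Equiv.mk compl compl compl_compl compl_compl) _ _ fun T => rfl
  -- antipodal pairing: the mean of a super-odd twisted-monotone function over a red-dominated cube is nonnegative
  have hmean : ∀ {K : Set V → Set V → ℝ}, (∀ ⦃P P' Q Q' : Set V⦄, P ⊆ P' → Q' ⊆ Q → K P Q ≤ K P' Q') →
      (∀ P Q, 0 ≤ K P Q + K Q P) → 0 ≤ ∑ T : Set ι, K (Wr T) (Wb T) := by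
    intro K hK hso
    have htwice : 2 * ∑ T : Set ι, K (Wr T) (Wb T) = ∑ T : Set ι, (K (Wr T) (Wb T) + K (Wr Tᶜ) (Wb Tᶜ)) := by
      rw [Finset.sum_add_distrib, hsumc (fun T => K (Wr T) (Wb T))]; ring
    have h3 : 0 ≤ ∑ T : Set ι, (K (Wr T) (Wb T) + K (Wr Tᶜ) (Wb Tᶜ)) :=
      Finset.sum_nonneg fun T _ => by
        -- `swap (Wr T, Wb T) ≼ (Wr Tᶜ, Wb Tᶜ)`: `Wb T ⊆ Wr Tᶜ` and `Wb Tᶜ ⊆ Wr T`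
        have h1 : Wb T ⊆ Wr Tᶜ := by have := hdom Tᶜ; rwa [compl_compl] at this
        have h2 : K (Wb T) (Wr T) ≤ K (Wr Tᶜ) (Wb Tᶜ) := hK h1 (hdom T)
        have h4 := hso (Wr T) (Wb T)
        linarith
    linarith
  have hprod : 0 ≤ (∑ T, a T) * ∑ T, b T := mul_nonneg (hmean hK₁ hso₁) (hmean hK₂ hso₂)
  have hH := harris_uniform_cov ha hb
  have hN : (0 : ℝ) < (Fintype.card (Set ι) : ℝ) := by exact_mod_cast Fintype.card_pos
  nlinarith

/-- **Abstract cut-vertex composition** (HOME/THEOREM-OneSided.md, THEOREM OS⊕-C).  Side 1: a finite family of pairs `(P₁ j, Q₁ j)` that is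
⊕-POSITIVE — `Σ_j K₁ (P₁ j) (Q₁ j) * K₂ (P₁ j) (Q₁ j) ≥ 0` for all twisted-monotone super-odd `K₁, K₂`.  Side 2: a red-dominated cube
`(Wr, Wb)` on `Set ι`.  Then for odd twisted-monotone `h₁, h₂` and any fixed set `A`,
`0 ≤ Σ_j Σ_T h₁ (P₁ j ∪ Wr T ∪ A) (Q₁ j ∪ Wb T) * h₂ (P₁ j ∪ Wr T ∪ A) (Q₁ j ∪ Wb T)`. [this work] -/
theorem oplus_composition_sum_nonneg {J : Type*} [Fintype J] (P₁ Q₁ : J → Set V)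
    (hplus : ∀ K₁ K₂ : Set V → Set V → ℝ,
      (∀ ⦃P P' Q Q' : Set V⦄, P ⊆ P' → Q' ⊆ Q → K₁ P Q ≤ K₁ P' Q') → (∀ P Q, 0 ≤ K₁ P Q + K₁ Q P) →
      (∀ ⦃P P' Q Q' : Set V⦄, P ⊆ P' → Q' ⊆ Q → K₂ P Q ≤ K₂ P' Q') → (∀ P Q, 0 ≤ K₂ P Q + K₂ Q P) →
      0 ≤ ∑ j, K₁ (P₁ j) (Q₁ j) * K₂ (P₁ j) (Q₁ j))
    (Wr Wb : Set ι → Set V) (hWr : Monotone Wr) (hWb : Antitone Wb) (hdom : ∀ T, Wb Tᶜ ⊆ Wr T) (A : Set V)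
    {h₁ h₂ : Set V → Set V → ℝ}
    (hh₁ : ∀ ⦃P P' Q Q' : Set V⦄, P ⊆ P' → Q' ⊆ Q → h₁ P Q ≤ h₁ P' Q') (hodd₁ : ∀ P Q, h₁ Q P = -h₁ P Q)
    (hh₂ : ∀ ⦃P P' Q Q' : Set V⦄, P ⊆ P' → Q' ⊆ Q → h₂ P Q ≤ h₂ P' Q') (hodd₂ : ∀ P Q, h₂ Q P = -h₂ P Q) :
    0 ≤ ∑ j, ∑ T : Set ι, h₁ (P₁ j ∪ Wr T ∪ A) (Q₁ j ∪ Wb T) * h₂ (P₁ j ∪ Wr T ∪ A) (Q₁ j ∪ Wb T) := by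
  -- the side-2-averaged test functions
  let K₁ : Set V → Set V → ℝ := fun P Q => ∑ T : Set ι, h₁ (P ∪ Wr T ∪ A) (Q ∪ Wb T)
  let K₂ : Set V → Set V → ℝ := fun P Q => ∑ T : Set ι, h₂ (P ∪ Wr T ∪ A) (Q ∪ Wb T)
  have hsumc : ∀ (c : Set ι → ℝ), ∑ T : Set ι, c Tᶜ = ∑ T : Set ι, c T := fun c =>
    Fintype.sum_equiv (Equiv.mk compl compl compl_compl compl_compl) _ _ fun T => rfl
  -- they are twisted-monotone …
  have hKmono : ∀ {h : Set V → Set V → ℝ}, (∀ ⦃P P' Q Q' : Set V⦄, P ⊆ P' → Q' ⊆ Q → h P Q ≤ h P' Q') →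
      ∀ ⦃P P' Q Q' : Set V⦄, P ⊆ P' → Q' ⊆ Q →
        (∑ T : Set ι, h (P ∪ Wr T ∪ A) (Q ∪ Wb T)) ≤ ∑ T : Set ι, h (P' ∪ Wr T ∪ A) (Q' ∪ Wb T) := by
    intro h hh P P' Q Q' hP hQ
    exact Finset.sum_le_sum fun T _ => hh (Set.union_subset_union_left _ (Set.union_subset_union_left _ hP))
      (Set.union_subset_union_left _ hQ)
  -- … and super-odd, by antipodal domination
  have hKso : ∀ {h : Set V → Set V → ℝ}, (∀ ⦃P P' Q Q' : Set V⦄, P ⊆ P' → Q' ⊆ Q → h P Q ≤ h P' Q') →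
      (∀ P Q, h Q P = -h P Q) →
      ∀ P Q, 0 ≤ (∑ T : Set ι, h (P ∪ Wr T ∪ A) (Q ∪ Wb T)) + ∑ T : Set ι, h (Q ∪ Wr T ∪ A) (P ∪ Wb T) := by
    intro h hh hodd P Q
    rw [← hsumc (fun T => h (Q ∪ Wr T ∪ A) (P ∪ Wb T)), ← Finset.sum_add_distrib]
    refine Finset.sum_nonneg fun T _ => ?_
    have h1 : Wb T ⊆ Wr Tᶜ := by have := hdom Tᶜ; rwa [compl_compl] at this
    -- h (Q ∪ Wr Tᶜ ∪ A) (P ∪ Wb Tᶜ) = - h (P ∪ Wb Tᶜ) (Q ∪ Wr Tᶜ ∪ A) ≥ - h (P ∪ Wr T ∪ A) (Q ∪ Wb T)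
    have h2 : h (P ∪ Wb Tᶜ) (Q ∪ Wr Tᶜ ∪ A) ≤ h (P ∪ Wr T ∪ A) (Q ∪ Wb T) := by
      apply hh
      · intro v hv
        rcases hv with hv | hv
        · exact Or.inl (Or.inl hv)
        · exact Or.inl (Or.inr (hdom T hv))
      · intro v hv
        rcases hv with hv | hv
        · exact Or.inl (Or.inl hv)
        · exact Or.inl (Or.inr (h1 hv))
    have h3 := hodd (P ∪ Wb Tᶜ) (Q ∪ Wr Tᶜ ∪ A)
    show 0 ≤ h (P ∪ Wr T ∪ A) (Q ∪ Wb T) + h (Q ∪ Wr Tᶜ ∪ A) (P ∪ Wb Tᶜ)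
    linarith
  have hpos := hplus K₁ K₂ (hKmono hh₁) (hKso hh₁ hodd₁) (hKmono hh₂) (hKso hh₂ hodd₂)
  -- Harris in `T` for each `j`
  have hN : (0 : ℝ) < (Fintype.card (Set ι) : ℝ) := by exact_mod_cast Fintype.card_pos
  have hj : ∀ j, K₁ (P₁ j) (Q₁ j) * K₂ (P₁ j) (Q₁ j) ≤ (Fintype.card (Set ι) : ℝ) *
      ∑ T : Set ι, h₁ (P₁ j ∪ Wr T ∪ A) (Q₁ j ∪ Wb T) * h₂ (P₁ j ∪ Wr T ∪ A) (Q₁ j ∪ Wb T) := by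
    intro j
    refine harris_uniform_cov (a := fun T => h₁ (P₁ j ∪ Wr T ∪ A) (Q₁ j ∪ Wb T))
      (b := fun T => h₂ (P₁ j ∪ Wr T ∪ A) (Q₁ j ∪ Wb T)) ?_ ?_
    · intro T T' hTT'
      exact hh₁ (Set.union_subset_union_left _ (Set.union_subset_union_right _ (hWr hTT')))
        (Set.union_subset_union_right _ (hWb hTT'))
    · intro T T' hTT'
      exact hh₂ (Set.union_subset_union_left _ (Set.union_subset_union_right _ (hWr hTT')))
        (Set.union_subset_union_right _ (hWb hTT'))
  have hsum : ∑ j, K₁ (P₁ j) (Q₁ j) * K₂ (P₁ j) (Q₁ j) ≤ (Fintype.card (Set ι) : ℝ) *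
      ∑ j, ∑ T : Set ι, h₁ (P₁ j ∪ Wr T ∪ A) (Q₁ j ∪ Wb T) * h₂ (P₁ j ∪ Wr T ∪ A) (Q₁ j ∪ Wb T) := by
    rw [Finset.mul_sum]
    exact Finset.sum_le_sum fun j _ => hj j
  have this : 0 ≤ (Fintype.card (Set ι) : ℝ) *
      ∑ j, ∑ T : Set ι, h₁ (P₁ j ∪ Wr T ∪ A) (Q₁ j ∪ Wb T) * h₂ (P₁ j ∪ Wr T ∪ A) (Q₁ j ∪ Wb T) := le_trans hpos hsum
  exact (mul_nonneg_iff_of_pos_left hN).1 this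

/-- **Products of one-sided cubes** (HOME/THEOREM-OneSided.md, Corollary of Lemma 1 / THEOREM OS⊕-C with a cube as side 1): for red-dominated
cubes `(Vr, Vb)` on `Set κ` and `(Wr, Wb)` on `Set ι`, odd twisted-monotone `h₁, h₂` and a fixed set `A`,
`0 ≤ Σ_S Σ_T h₁ (Vr S ∪ Wr T ∪ A) (Vb S ∪ Wb T) * h₂ (…)`. [this work] -/
theorem cube_composition_sum_nonneg {κ : Type*} [Fintype κ] (Vr Vb : Set κ → Set V) (hVr : Monotone Vr) (hVb : Antitone Vb)
    (hVdom : ∀ S, Vb Sᶜ ⊆ Vr S)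
    (Wr Wb : Set ι → Set V) (hWr : Monotone Wr) (hWb : Antitone Wb) (hdom : ∀ T, Wb Tᶜ ⊆ Wr T) (A : Set V)
    {h₁ h₂ : Set V → Set V → ℝ}
    (hh₁ : ∀ ⦃P P' Q Q' : Set V⦄, P ⊆ P' → Q' ⊆ Q → h₁ P Q ≤ h₁ P' Q') (hodd₁ : ∀ P Q, h₁ Q P = -h₁ P Q)
    (hh₂ : ∀ ⦃P P' Q Q' : Set V⦄, P ⊆ P' → Q' ⊆ Q → h₂ P Q ≤ h₂ P' Q') (hodd₂ : ∀ P Q, h₂ Q P = -h₂ P Q) :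
    0 ≤ ∑ S : Set κ, ∑ T : Set ι, h₁ (Vr S ∪ Wr T ∪ A) (Vb S ∪ Wb T) * h₂ (Vr S ∪ Wr T ∪ A) (Vb S ∪ Wb T) :=
  oplus_composition_sum_nonneg Vr Vb
    (fun _ _ hK₁ hso₁ hK₂ hso₂ => superodd_cube_sum_nonneg Vr Vb hVr hVb hVdom hK₁ hso₁ hK₂ hso₂)
    Wr Wb hWr hWb hdom A hh₁ hodd₁ hh₂ hodd₂

end OneSided

end Antithetic

end Summit.CriticalPhenomena.PercolationContinuityZ3.Theorems
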